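import Literature.MathematicalPhysics.QuantumLattice.HubbardInteractionMoments
import Literature.MathematicalPhysics.QuantumLattice.FermionicTimeKernelAveraging
import HarnessLib

/-!
# The Fejér top cutoff on the Matsubara frequencies: its synthesis kernel has `L¹` norm exactly one

Topic `MathematicalPhysics/QuantumLattice`; the smooth ultraviolet truncation used in the Matsubara-UV step of the cell gate-hubbard-kl
(R0, ARCH-β P3): on the `2M` fermionic frequencies `ω_n = π(2n+1)/β`, `n ∈ [-M, M)`, the FEJÉR weights `χ_n = 1 - |n|/M`.  Their
synthesis kernel `F(s) = (1/β) Σ_n χ_n e^{iω_n s}` is `(βM)⁻¹ e^{iπs/β} |Σ_{j<M} e^{2πijs/β}|²` — a phase times Fejér's kernel — so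
`|F(s)| = (βM)⁻¹ |Σ_{j<M} e^{2πijs/β}|²` and `∫₀^β |F| = 1` by orthogonality of the exponentials (Fejér 1904; Katznelson, *An
Introduction to Harmonic Analysis*, Ch. I §2.5: Fejér's kernel `K_n = Σ (1 - |j|/(n+1)) e^{ijt} = (n+1)⁻¹ (sin((n+1)t/2)/sin(t/2))²`, `‖K_n‖₁ = 1`).  This is the `‖F‖₁ = O(1)` that makes the row-averaged Pedra–Salmhofer bound uniform in `M`
(`FermionicTimeKernelAveraging`, `Literature.Analysis.Matrix.norm_det_row_integral_le`).

* `fejerWeight M n = 1 - |n|/M` (as a real number; `= 0` at `n = -M`); `fejerWeight_nonneg/le_one` on `[-M, M)`;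
* `card_filter_sub_eq` — `#{(j, j') ∈ [0,M)² : j - j' = n} = M - |n|` for `|n| ≤ M`;
* `sum_matsubara_fejer_eq_sum_sum` — `Σ_{i} (M - |n_i|) f(n_i) = Σ_{j,j'<M} f(j - j')` (regrouping by the difference);
* **`norm_freqKernel_fejer_eq`** — `‖F(s)‖ = (βM)⁻¹ ‖Σ_{j<M} e^{2πijs/β}‖²`;
* **`integral_norm_freqKernel_fejer`** — `∫₀^β ‖F(s)‖ ds = 1` (`M ≥ 1`, `β > 0`).

Everything is PROVED; `fejerWeight` is the only definition; no named facts.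

## Sources

Y. Katznelson, *An Introduction to Harmonic Analysis* (3rd ed., Cambridge 2004), Ch. I §2.5, (2.5) and Lemma 2.5 [`Katznelson2004`];
W. de Siqueira Pedra, M. Salmhofer, Comm. Math. Phys. 282 (2008) 797–818, §2 (2.8) [`PedraSalmhofer2008`].
-/

noncomputable section

open MeasureTheory Set Finset intervalIntegral Literature.Probability.LatticeModels

namespace Literature.MathematicalPhysics.QuantumLattice

/-! ### The weights and the counting lemma -/

/-- The **Fejér weight** `χ_n = 1 - |n|/M` of the integer frequency label `n` (Katznelson I (2.5): the Cesàro means of the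
Fourier partial sums have the triangle `1 - |n|/M` as multipliers). [cite: Katznelson2004, Ch. I §2.5 (2.5)] -/
def fejerWeight (M : ℕ) (n : ℤ) : ℝ := 1 - |(n : ℝ)| / M

/-- `0 ≤ χ_n` for `|n| ≤ M`. [cite: Katznelson2004, Ch. I §2.5 (2.5)] -/
theorem fejerWeight_nonneg {M : ℕ} (hM : 0 < M) {n : ℤ} (hn : |n| ≤ M) : 0 ≤ fejerWeight M n := by
  have hM' : (0 : ℝ) < M := by exact_mod_cast hM
  have hn' : |(n : ℝ)| ≤ M := by exact_mod_cast hn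
  rw [fejerWeight, sub_nonneg, div_le_one hM']
  exact hn'

/-- `χ_n ≤ 1`. [cite: Katznelson2004, Ch. I §2.5 (2.5)] -/
theorem fejerWeight_le_one (M : ℕ) (n : ℤ) : fejerWeight M n ≤ 1 := by
  rw [fejerWeight, sub_le_self_iff]
  positivity

/-- `M · χ_n = M - |n|`. [cite: Katznelson2004, Ch. I §2.5 (2.5)] -/
theorem natCast_mul_fejerWeight {M : ℕ} (hM : 0 < M) (n : ℤ) : (M : ℝ) * fejerWeight M n = M - |(n : ℝ)| := by
  have hM' : (M : ℝ) ≠ 0 := by exact_mod_cast hM.ne'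
  rw [fejerWeight, mul_sub, mul_one, mul_div_cancel₀ _ hM']

/-- **Counting the pairs with a given difference**: for `|n| ≤ M`, `#{(j, j') ∈ [0, M)² : j - j' = n} = M - |n|`.
[cite: Katznelson2004, Ch. I §2.5 (2.5)] -/
theorem card_filter_sub_eq (M : ℕ) (n : ℤ) (hn : |n| ≤ M) :
    ((range M ×ˢ range M).filter fun p : ℕ × ℕ => (p.1 : ℤ) - p.2 = n).card = M - n.natAbs := by
  -- the fibre is the image of `j' ↦ (j' + n, j')` over the admissible `j'`
  rcases le_or_gt 0 n with hn0 | hn0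
  · -- `n ≥ 0`: `j' ∈ [0, M - n)`, `j = j' + n`
    obtain ⟨k, rfl⟩ := Int.eq_ofNat_of_zero_le hn0
    have hk : k ≤ M := by simpa using hn
    have h : (range M ×ˢ range M).filter (fun p : ℕ × ℕ => (p.1 : ℤ) - p.2 = (k : ℤ)) =
        (range (M - k)).image fun j' => (j' + k, j') := by
      ext ⟨a, b⟩
      simp only [Finset.mem_filter, Finset.mem_product, Finset.mem_range, Finset.mem_image, Prod.mk.injEq]
      constructor
      · rintro ⟨⟨ha, hb⟩, hab⟩
        refine ⟨b, by omega, by omega, rfl⟩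
      · rintro ⟨j', hj', rfl, rfl⟩
        exact ⟨⟨by omega, by omega⟩, by push_cast; ring⟩
    rw [h, Finset.card_image_of_injective _ fun x y hxy => (Prod.mk.inj hxy).2, Finset.card_range, Int.natAbs_natCast]
  · -- `n < 0`: `j ∈ [0, M + n)`, `j' = j - n`
    obtain ⟨k, hk⟩ := Int.exists_eq_neg_ofNat (le_of_lt hn0)
    subst hk
    have hk : k ≤ M := by simpa using hn
    have h : (range M ×ˢ range M).filter (fun p : ℕ × ℕ => (p.1 : ℤ) - p.2 = -(k : ℤ)) =
        (range (M - k)).image fun j => (j, j + k) := by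
      ext ⟨a, b⟩
      simp only [Finset.mem_filter, Finset.mem_product, Finset.mem_range, Finset.mem_image, Prod.mk.injEq]
      constructor
      · rintro ⟨⟨ha, hb⟩, hab⟩
        refine ⟨a, by omega, rfl, by omega⟩
      · rintro ⟨j, hj, rfl, rfl⟩
        exact ⟨⟨by omega, by omega⟩, by push_cast; ring⟩
    rw [h, Finset.card_image_of_injective _ fun x y hxy => (Prod.mk.inj hxy).1, Finset.card_range, Int.natAbs_neg, Int.natAbs_natCast]

/-- The integer labels `n_i = i - M` are injective in `i`. [cite: Katznelson2004, Ch. I §2.5 (2.5)] -/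
theorem matsubaraInt_injective (M : ℕ) : Function.Injective (matsubaraInt M) := by
  intro i j h
  simp only [matsubaraInt] at h
  exact Fin.ext (by exact_mod_cast (sub_left_inj.1 h))

/-- **Regrouping a double sum by the difference**: for `f : ℤ → ℂ`,
`Σ_{j<M} Σ_{j'<M} f(j - j') = Σ_{i : MatsubaraIdx M} (M - |n_i|) f(n_i)` — the differences `j - j'` range over `(-M, M) ⊆ [-M, M)`,
each attained `M - |n|` times, and the label `n = -M` carries the weight `0` (Katznelson I (2.5): `K_M = (1/M)|Σ_{j<M} e^{ijx}|²`).
[cite: Katznelson2004, Ch. I §2.5 (2.5)] -/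
theorem sum_sum_eq_sum_matsubara_fejer (M : ℕ) (f : ℤ → ℂ) :
    ∑ j ∈ range M, ∑ j' ∈ range M, f ((j : ℤ) - j') =
      ∑ i : MatsubaraIdx M, ((M - |(matsubaraInt M i : ℝ)| : ℝ) : ℂ) * f (matsubaraInt M i) := by
  classical
  set s : Finset (ℕ × ℕ) := range M ×ˢ range M with hs
  set d : ℕ × ℕ → ℤ := fun p => (p.1 : ℤ) - p.2 with hd
  rw [← Finset.sum_product' (f := fun j j' : ℕ => f ((j : ℤ) - j'))]
  change ∑ p ∈ s, f (d p) = _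
  rw [Finset.sum_comp]
  -- enlarge the index set of differences to the image of `matsubaraInt` (empty fibres contribute `0`)
  have hsub : s.image d ⊆ (univ : Finset (MatsubaraIdx M)).image (matsubaraInt M) := by
    intro b hb
    obtain ⟨p, hp, rfl⟩ := Finset.mem_image.1 hb
    rw [hs, Finset.mem_product, Finset.mem_range, Finset.mem_range] at hp
    refine Finset.mem_image.2 ⟨⟨p.1 + M - p.2, by omega⟩, Finset.mem_univ _, ?_⟩
    simp only [matsubaraInt, hd]
    push_cast [Nat.cast_sub (by omega : p.2 ≤ p.1 + M)]
    ring
  rw [Finset.sum_subset hsub (fun b _ hb => by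
    rw [Finset.mem_image, not_exists] at hb
    have h0 : s.filter (fun a => d a = b) = ∅ :=
      Finset.filter_eq_empty_iff.2 fun p hp hpb => hb p ⟨hp, hpb⟩
    rw [h0, Finset.card_empty, zero_smul])]
  rw [Finset.sum_image fun i _ j _ h => matsubaraInt_injective M h]
  refine Finset.sum_congr rfl fun i _ => ?_
  -- the fibre over `n_i` has `M - |n_i|` elements
  have hni : |matsubaraInt M i| ≤ M := by
    have h1 := i.isLt
    rw [abs_le, matsubaraInt]
    constructor <;> omega
  have hle : (matsubaraInt M i).natAbs ≤ M := by
    have h := hni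
    rw [Int.abs_eq_natAbs] at h
    exact_mod_cast h
  rw [hs, hd, card_filter_sub_eq M _ hni, nsmul_eq_mul]
  congr 1
  have hR : (((M - (matsubaraInt M i).natAbs : ℕ) : ℝ)) = (M : ℝ) - |(matsubaraInt M i : ℝ)| := by
    rw [Nat.cast_sub hle, Nat.cast_natAbs, Int.cast_abs]
  rw [← hR]
  push_cast
  rfl

/-! ### The synthesis kernel of the Fejér weights -/

variable {M : ℕ}

/-- The fermionic frequencies satisfy `e^{-iω_nβ} = -1` (`ω_n β = π(2n+1)`). [cite: Katznelson2004, Ch. I §2.5 (2.5)] -/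
theorem exp_neg_matsubaraFreq_mul_beta {β : ℝ} (hβ : β ≠ 0) (i : MatsubaraIdx M) :
    Complex.exp (-(((matsubaraFreq β M i * β : ℝ) : ℂ) * Complex.I)) = -1 := by
  have h : matsubaraFreq β M i * β = Real.pi * (2 * (matsubaraInt M i : ℝ) + 1) := by
    rw [matsubaraFreq]; field_simp
  rw [h]
  have h2 : -(((Real.pi * (2 * (matsubaraInt M i : ℝ) + 1) : ℝ) : ℂ) * Complex.I) =
      (-(matsubaraInt M i) - 1 : ℤ) * (2 * Real.pi * Complex.I) + Real.pi * Complex.I := by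
    push_cast; ring
  rw [h2, Complex.exp_add, Complex.exp_int_mul_two_pi_mul_I, one_mul, Complex.exp_pi_mul_I]

/-- **The synthesis kernel of the Fejér weights is a phase times the squared Dirichlet sum**:
`F(s) = (1/β) Σ_i χ_{n_i} e^{iω_{n_i} s} = (βM)⁻¹ e^{iπs/β} (Σ_{j<M} e^{2πijs/β}) (Σ_{j'<M} e^{-2πij's/β})` (`M ≥ 1`).
[cite: Katznelson2004, Ch. I §2.5 (2.5)] -/
theorem freqKernel_fejer_eq (β : ℝ) (hM : 0 < M) (s : ℝ) :
    freqKernel β (matsubaraFreq β M) (fun i => ((fejerWeight M (matsubaraInt M i) : ℝ) : ℂ)) s =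
      ((1 / (β * M) : ℝ) : ℂ) * Complex.exp (((Real.pi * s / β : ℝ) : ℂ) * Complex.I) *
        ((∑ j ∈ range M, Complex.exp (((2 * Real.pi * j * s / β : ℝ) : ℂ) * Complex.I)) *
          ∑ j' ∈ range M, Complex.exp (-(((2 * Real.pi * j' * s / β : ℝ) : ℂ) * Complex.I))) := by
  have hM' : (M : ℝ) ≠ 0 := by exact_mod_cast hM.ne'
  -- the double sum regrouped by the difference `n = j - j'`
  have hreg := sum_sum_eq_sum_matsubara_fejer M fun n => Complex.exp (((2 * Real.pi * n * s / β : ℝ) : ℂ) * Complex.I)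
  have hprod : (∑ j ∈ range M, Complex.exp (((2 * Real.pi * j * s / β : ℝ) : ℂ) * Complex.I)) *
      ∑ j' ∈ range M, Complex.exp (-(((2 * Real.pi * j' * s / β : ℝ) : ℂ) * Complex.I)) =
      ∑ j ∈ range M, ∑ j' ∈ range M, Complex.exp (((2 * Real.pi * ((j : ℤ) - j' : ℤ) * s / β : ℝ) : ℂ) * Complex.I) := by
    rw [Finset.sum_mul_sum]
    refine Finset.sum_congr rfl fun j _ => Finset.sum_congr rfl fun j' _ => ?_
    rw [← Complex.exp_add]
    congr 1; push_cast; ring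
  rw [hprod, hreg, freqKernel, Finset.mul_sum, Finset.mul_sum]
  refine Finset.sum_congr rfl fun i _ => ?_
  have hMc : (M : ℂ) ≠ 0 := by exact_mod_cast hM.ne'
  have hw : ((fejerWeight M (matsubaraInt M i) : ℝ) : ℂ) =
      ((1 / M : ℝ) : ℂ) * ((M - |(matsubaraInt M i : ℝ)| : ℝ) : ℂ) := by
    rw [← natCast_mul_fejerWeight hM]
    push_cast
    rw [one_div, ← mul_assoc, inv_mul_cancel₀ hMc, one_mul]
  have hph : Complex.exp (((matsubaraFreq β M i * s : ℝ) : ℂ) * Complex.I) =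
      Complex.exp (((Real.pi * s / β : ℝ) : ℂ) * Complex.I) *
        Complex.exp (((2 * Real.pi * (matsubaraInt M i : ℤ) * s / β : ℝ) : ℂ) * Complex.I) := by
    rw [← Complex.exp_add]; congr 1
    rw [matsubaraFreq]; push_cast; field_simp; ring
  rw [hw, hph]
  push_cast
  field_simp

/-- **The modulus of the synthesis kernel**: `‖F(s)‖ = (βM)⁻¹ ‖Σ_{j<M} e^{2πijs/β}‖²` (`β > 0`, `M ≥ 1`).
[cite: Katznelson2004, Ch. I §2.5 (2.5)] -/
theorem norm_freqKernel_fejer_eq {β : ℝ} (hβ : 0 < β) (hM : 0 < M) (s : ℝ) :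
    ‖freqKernel β (matsubaraFreq β M) (fun i => ((fejerWeight M (matsubaraInt M i) : ℝ) : ℂ)) s‖ =
      (1 / (β * M)) * ‖∑ j ∈ range M, Complex.exp (((2 * Real.pi * j * s / β : ℝ) : ℂ) * Complex.I)‖ ^ 2 := by
  rw [freqKernel_fejer_eq β hM s, norm_mul, norm_mul, norm_mul, Complex.norm_exp_ofReal_mul_I, mul_one,
    Complex.norm_real, Real.norm_eq_abs, abs_of_pos (by positivity), sq]
  congr 1
  -- the second Dirichlet sum is the conjugate of the first
  have hconj : ∑ j' ∈ range M, Complex.exp (-(((2 * Real.pi * j' * s / β : ℝ) : ℂ) * Complex.I)) =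
      (starRingEnd ℂ) (∑ j ∈ range M, Complex.exp (((2 * Real.pi * j * s / β : ℝ) : ℂ) * Complex.I)) := by
    rw [map_sum]
    refine Finset.sum_congr rfl fun j _ => ?_
    rw [← Complex.exp_conj, map_mul, Complex.conj_ofReal, Complex.conj_I, mul_neg]
  rw [hconj, Complex.norm_conj]

/-- **The synthesis kernel of the Fejér weights has `L¹` norm one**: `∫₀^β ‖F(s)‖ ds = 1` (`β > 0`, `M ≥ 1`) — Parseval for the
Dirichlet sum, `∫₀^β |Σ_{j<M} e^{2πijs/β}|² ds = Mβ`. [cite: Katznelson2004, Ch. I §2.5 Lemma 2.5] -/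
theorem integral_norm_freqKernel_fejer {β : ℝ} (hβ : 0 < β) (hM : 0 < M) :
    ∫ s in (0 : ℝ)..β, ‖freqKernel β (matsubaraFreq β M) (fun i => ((fejerWeight M (matsubaraInt M i) : ℝ) : ℂ)) s‖ = 1 := by
  simp_rw [norm_freqKernel_fejer_eq hβ hM]
  rw [intervalIntegral.integral_const_mul]
  set D : ℝ → ℂ := fun s => ∑ j ∈ range M, Complex.exp (((2 * Real.pi * j * s / β : ℝ) : ℂ) * Complex.I) with hD
  -- `‖D(s)‖²` as a complex number is the double exponential sum
  have hsq : ∀ s : ℝ, (((‖D s‖ ^ 2 : ℝ)) : ℂ) =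
      ∑ j ∈ range M, ∑ j' ∈ range M, Complex.exp (((2 * Real.pi * (((j : ℤ) - j' : ℤ) : ℝ) * s / β : ℝ) : ℂ) * Complex.I) := by
    intro s
    rw [← Complex.normSq_eq_norm_sq, ← Complex.mul_conj, hD]
    dsimp only
    rw [map_sum, Finset.sum_mul_sum]
    refine Finset.sum_congr rfl fun j _ => Finset.sum_congr rfl fun j' _ => ?_
    rw [← Complex.exp_conj, map_mul, Complex.conj_ofReal, Complex.conj_I, ← Complex.exp_add]
    congr 1; push_cast; ring
  -- Parseval: `∫₀^β Σ_{j,j'} e^{2πi(j-j')s/β} ds = Mβ`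
  have hone : ∀ j j' : ℕ, ∫ s in (0 : ℝ)..β,
      Complex.exp (((2 * Real.pi * (((j : ℤ) - j' : ℤ) : ℝ) * s / β : ℝ) : ℂ) * Complex.I) =
        if (j : ℤ) - j' = 0 then (β : ℂ) else 0 := by
    intro j j'
    rw [intervalIntegral.integral_of_le hβ.le, ← integral_Icc_eq_integral_Ioc]
    exact integral_Icc_exp_freqTransfer hβ ((j : ℤ) - j')
  have hpar : ∫ s in (0 : ℝ)..β, ∑ j ∈ range M, ∑ j' ∈ range M,
      Complex.exp (((2 * Real.pi * (((j : ℤ) - j' : ℤ) : ℝ) * s / β : ℝ) : ℂ) * Complex.I) = ((M * β : ℝ) : ℂ) := by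
    have hI : ∀ j ∈ range M, IntervalIntegrable (fun s : ℝ => ∑ j' ∈ range M,
        Complex.exp (((2 * Real.pi * (((j : ℤ) - j' : ℤ) : ℝ) * s / β : ℝ) : ℂ) * Complex.I)) volume 0 β := by
      intro j _
      apply Continuous.intervalIntegrable
      fun_prop
    rw [intervalIntegral.integral_finsetSum hI]
    have hj : ∀ j ∈ range M, ∫ s in (0 : ℝ)..β, ∑ j' ∈ range M,
        Complex.exp (((2 * Real.pi * (((j : ℤ) - j' : ℤ) : ℝ) * s / β : ℝ) : ℂ) * Complex.I) = (β : ℂ) := by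
      intro j hj
      have hI' : ∀ j' ∈ range M, IntervalIntegrable (fun s : ℝ =>
          Complex.exp (((2 * Real.pi * (((j : ℤ) - j' : ℤ) : ℝ) * s / β : ℝ) : ℂ) * Complex.I)) volume 0 β := by
        intro j' _
        apply Continuous.intervalIntegrable
        fun_prop
      rw [intervalIntegral.integral_finsetSum hI']
      simp_rw [hone]
      rw [Finset.sum_eq_single j (fun j' _ hj' => if_neg (by omega)) (fun h => absurd hj h), if_pos (sub_self _)]
    rw [Finset.sum_congr rfl hj, Finset.sum_const, card_range, nsmul_eq_mul]
    push_cast; ring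
  -- hence `∫₀^β ‖D‖² = Mβ`
  have hreal : ∫ s in (0 : ℝ)..β, ‖D s‖ ^ 2 = M * β := by
    have h := intervalIntegral.integral_ofReal (f := fun s => ‖D s‖ ^ 2) (a := 0) (b := β) (μ := volume)
    simp_rw [hsq] at h
    rw [hpar] at h
    exact_mod_cast h.symm
  rw [hreal]
  have hM' : (M : ℝ) ≠ 0 := by exact_mod_cast hM.ne'
  field_simp

end Literature.MathematicalPhysics.QuantumLattice

end
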